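import Summits.CriticalPhenomena.PercolationContinuityZ3.Theorems.PercNearOneGluingNoHeavyLowerTailSahiGridPatternPairThirdKleitman

/-!
# `NoHeavyLowerTail` (crux stmt-CriticalPhenomena-4575), Sahi programme P1: **THE CROSSED FAMILY AT THE CANONICAL CERTIFICATE** —
# Conjecture A for `x ∨ y` at crossed test pairs with the inner vector `d_V = λ_V`, for EVERY up-set `V` (every `k`)

Support file (Sahi cell, seat `prim-sahi-p1`, generation 43; `--supports stmt-CriticalPhenomena-4575`).  Pure proofs, no definitions, no `sorry`,
standard axioms.  Vocabulary of `…SahiGridPattern{,CellForm,DiagCert,CoCountProductNCrossed,PairThirdKleitman}` (`glue`, `ind`, `thetaVal`, `lamU`,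
`TotDist`, `thirdPt`, `freeOf`, `cellOf`).

THE MATHEMATICS (seat memo FROM-prim-sahi-p1-gen43).  Outer block `S = {x≥1} ∨ {y≥1} ⊆ [3]²` with its recursive certificate `c = (0 | 4 | 2 | 5)`, inner
block `V ⊆ [3]^k`, `A = S × V`, crossed test pairs `P = {x≥1}×A₀`, `Q = {q∈B′} ∪ ({y≥1}×B)` (`B′ ⊆ B`).  By the landed monotonicity of condition (N) of the
co-count product in the inner vector, the WEAKEST instance of Conjecture A is the one with the CANONICAL inner vector `d_V = λ_V = 2^{k+1}·1_V − ν_V` (the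
`≼`-largest vector with (T); it satisfies (N) exactly when `V` is good).  With `d_V = λ_V` every inner quantity is an explicit pair count, and the intrinsic
inequality `hX` of `diagCert_coProduct_N_orTwo_crossed` becomes, writing `F = A₀∩B′`, `H_V(F) = 2^k#(F∩V) − N(V;F)`, `h_V(X,Y) = 2^k#(X∩Y∩V) − N(X∩V;Y)`,
`κ′_V(A₀,B′) = #{(q,r)∈A₀×B′ : q δ̸ r, q∈V} − #{… : q̄r ∈ V}` and `Φ_V(X,Y) = λ_V(X∩Y) − Θ_V(X×Y)` (the goodness slack):
  `hX ⟺ Φ_V(A₀,B′) + [2H_V(F) + h_V(A₀,B) + h_V(B,A₀) − κ′_V(A₀,B′)] ≥ 0`,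
because of the IDENTITY `H_V(F) + h_V(B′,A₀) − κ′_V(A₀,B′) = Φ_V(A₀,B′)`.  So, at the canonical certificate, (N) at a crossed pair follows from goodness of
`V` at the two section rectangles `(A₀,B)`, `(A₀,B′)` and the single inequality
  (CR′)  `κ′_V(A₀,B′) ≤ 2·H_V(A₀∩B′) + h_V(A₀,B) + h_V(B,A₀)`.
* `diagCert_coProduct_N_orTwo_crossed_canonical` — this reduction (every `k`; (CR′) as hypothesis `hCR` in indicator sums).
* `kappa_le_harris_of_pairThird` — `κ′_V(A₀,B′) ≤ H_V(A₀)` for all up-sets `A₀, B′, V` (Kleitman at every third point, `pairThird_sum_le_inter`, with the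
  weight `φ = 1 − 1_{B′}`), whence (CR′) for `B = ⊤` (`h_V(A₀,⊤) = 0`, `h_V(⊤,A₀) = H_V(A₀)`, `H_V(F) ≥ 0`): `cr_top`.
* `diagCert_coProduct_N_orTwo_crossed_canonical_top` — UNCONDITIONAL (every `k`, EVERY up-set `V` good at the one rectangle `(A₀,B′)`): (N) of the co-count
  product `e = co(c, λ_V)` at every crossed pair with `B = ⊤`, i.e. `Q = {q ∈ B′} ∪ {y ≥ 1}`; `sStarD_blockAnd_orTwo_crossed_top_nonneg` — the pattern
  functional is `≥ 0` there.
(CR′) itself holds for ALL up-sets `A₀, B′ ⊆ B, V` of `[3]^k`, `k ≤ 3` (exhaustive: kit j295686, 941 192 000 triples with the minimising `B` by min-cut) and in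
120 000 / 6 000 random instances at `k = 4 / 5`; it is NOT a nonnegative combination of goodness rows at section words, Harris, Kleitman and third-point
Kleitman inequalities plus a pointwise-nonnegative remainder (LP, kit j295804) — like Conjecture D it needs an instance-dependent argument; open for general `k`.
Nothing in this file asserts Conjecture A in general, (CR′) for `k ≥ 4`, or `PatternPos d` for `d ≥ 4`. [this work]
-/

namespace Summit.CriticalPhenomena.PercolationContinuityZ3.Theorems.SahiGridPattern

open Finset SahiGrid3
open scoped BigOperators

section CrossedCanonical

variable {k : ℕ} {S Fx Gy : Finset (Pd (1 + 1))} {V : Finset (Pd k)} {A : Finset (Pd ((1 + 1) + k))}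

/-- Symmetry of the `δ̸` indicator. [this work] -/
theorem ite_totDist_comm (p q : Pd k) :
    (if TotDist p q = true then (1:ℤ) else 0) = (if TotDist q p = true then (1:ℤ) else 0) := by
  by_cases h : TotDist p q = true
  · rw [if_pos h, if_pos (totDist_comm.1 h)]
  · have h' : ¬ TotDist q p = true := fun hh => h (totDist_comm.1 hh)
    rw [if_neg h, if_neg h']

/-- `Σ_{q ∈ X∩Y} λ_V(q) = 2^{k+1}·#(X∩Y∩V) − N(V; X∩Y)` in indicator sums. [this work] -/
theorem sum_inter_lamU_eq (V X Y : Finset (Pd k)) :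
    (∑ q ∈ X ∩ Y, lamU V q) = 2 * (2:ℤ) ^ k * (∑ q : Pd k, ind X q * ind Y q * ind V q)
      - ∑ q : Pd k, ∑ r : Pd k, ind X q * ind Y q * (if TotDist q r = true then (1:ℤ) else 0) * ind V r := by
  rw [sum_mem_eq_sum_ind_mul (X ∩ Y), Finset.mul_sum, ← Finset.sum_sub_distrib]
  refine Finset.sum_congr rfl fun q _ => ?_
  unfold lamU
  rw [ind_inter_eq_mul, nuCount_eq_sum_ind]
  have e : (∑ r : Pd k, ind X q * ind Y q * (if TotDist q r = true then (1:ℤ) else 0) * ind V r)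
      = ind X q * ind Y q * ∑ p : Pd k, ind V p * (if TotDist p q = true then (1:ℤ) else 0) := by
    rw [Finset.mul_sum]
    refine Finset.sum_congr rfl fun r _ => ?_
    rw [ite_totDist_comm q r]; ring
  rw [e]; ring

/-- Swapping the partner and the third point inside a fibre sum: `Σ_r [q δ̸ r] f(r) g(q̄r) = Σ_r [q δ̸ r] f(q̄r) g(r)`. [this work] -/
theorem sum_partner_third_swap (q : Pd k) (f g : Pd k → ℤ) :
    (∑ r : Pd k, (if TotDist q r = true then (1:ℤ) else 0) * f r * g (thirdPt q r))
      = ∑ r : Pd k, (if TotDist q r = true then (1:ℤ) else 0) * f (thirdPt q r) * g r := by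
  rw [← sum_comp_thirdPt q (fun r => (if TotDist q r = true then (1:ℤ) else 0) * f (thirdPt q r) * g r)]
  refine Finset.sum_congr rfl fun r _ => ?_
  simp only [thirdPt_thirdPt, totDist_thirdPt_right]

/-- **`κ′_V(A₀,B′) ≤ H_V(A₀)` for all up-sets `A₀, B′, V` (every `k`)**: Kleitman at every third point with the weight `1 − 1_{B′}`. In indicator sums:
`#{(q,r)∈A₀×B′: q δ̸ r, q∈V} − #{(q,r)∈A₀×B′: q δ̸ r, q̄r∈V} ≤ 2^k·#(A₀∩V) − #{(q,r): q∈A₀, q δ̸ r, r∈V}`. [this work] -/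
theorem kappa_le_harris_of_pairThird (hV : IsUpperSet (V : Set (Pd k))) {A0 : Finset (Pd k)} (Bp : Finset (Pd k))
    (hA0 : IsUpperSet (A0 : Set (Pd k))) :
    (∑ q : Pd k, ∑ r : Pd k, ind A0 q * ind Bp r * (if TotDist q r = true then (1:ℤ) else 0) * ind V q)
      - (∑ q : Pd k, ∑ r : Pd k, ind A0 q * ind Bp r * (if TotDist q r = true then (1:ℤ) else 0) * ind V (thirdPt q r))
      ≤ (2:ℤ) ^ k * (∑ q : Pd k, ind A0 q * ind V q)
        - ∑ q : Pd k, ∑ r : Pd k, ind A0 q * (if TotDist q r = true then (1:ℤ) else 0) * ind V r := by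
  -- pairThird with X = A0, Y = V, φ = 1 − 1_{B′}
  have hφ : ∀ s : Pd k, 0 ≤ 1 - ind Bp s := by
    intro s; unfold ind; split_ifs <;> norm_num
  have hPT := pairThird_sum_le_inter hA0 hV (fun s => 1 - ind Bp s) hφ
  -- left side of PT: Σ 1_{A0}(q)1_V(r)[td] − Σ 1_{A0}(q)1_V(r)[td]1_{B′}(q̄r), and the last sum equals `mb` after the partner/third swap
  have eL : (∑ q : Pd k, ∑ r : Pd k, ind A0 q * ind V r * (if TotDist q r = true then (1:ℤ) else 0) * (1 - ind Bp (thirdPt q r)))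
      = (∑ q : Pd k, ∑ r : Pd k, ind A0 q * (if TotDist q r = true then (1:ℤ) else 0) * ind V r)
        - ∑ q : Pd k, ∑ r : Pd k, ind A0 q * ind Bp r * (if TotDist q r = true then (1:ℤ) else 0) * ind V (thirdPt q r) := by
    rw [← Finset.sum_sub_distrib]
    refine Finset.sum_congr rfl fun q _ => ?_
    have e2 : (∑ r : Pd k, ind A0 q * ind Bp r * (if TotDist q r = true then (1:ℤ) else 0) * ind V (thirdPt q r))
        = ∑ r : Pd k, ind A0 q * ind Bp (thirdPt q r) * (if TotDist q r = true then (1:ℤ) else 0) * ind V r := by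
      have h3 := sum_partner_third_swap q (fun r => ind Bp r) (fun r => ind V r)
      have e3 : (∑ r : Pd k, ind A0 q * ind Bp r * (if TotDist q r = true then (1:ℤ) else 0) * ind V (thirdPt q r))
          = ind A0 q * ∑ r : Pd k, (if TotDist q r = true then (1:ℤ) else 0) * ind Bp r * ind V (thirdPt q r) := by
        rw [Finset.mul_sum]; refine Finset.sum_congr rfl fun r _ => ?_; ring
      have e4 : (∑ r : Pd k, ind A0 q * ind Bp (thirdPt q r) * (if TotDist q r = true then (1:ℤ) else 0) * ind V r)
          = ind A0 q * ∑ r : Pd k, (if TotDist q r = true then (1:ℤ) else 0) * ind Bp (thirdPt q r) * ind V r := by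
        rw [Finset.mul_sum]; refine Finset.sum_congr rfl fun r _ => ?_; ring
      rw [e3, e4, h3]
    rw [e2, ← Finset.sum_sub_distrib]
    refine Finset.sum_congr rfl fun r _ => ?_
    ring
  -- right side of PT: Σ_m 1_{A0}(m)1_V(m) Σ_s [td](1 − 1_{B′}(s)) = 2^k nA − Σ 1_{A0}(q)1_V(q)[td]1_{B′}(r)
  have eR : (∑ m : Pd k, ∑ s : Pd k, ind A0 m * ind V m * (if TotDist m s = true then (1:ℤ) else 0) * (1 - ind Bp s))
      = (2:ℤ) ^ k * (∑ q : Pd k, ind A0 q * ind V q)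
        - ∑ q : Pd k, ∑ r : Pd k, ind A0 q * ind Bp r * (if TotDist q r = true then (1:ℤ) else 0) * ind V q := by
    rw [Finset.mul_sum, ← Finset.sum_sub_distrib]
    refine Finset.sum_congr rfl fun q _ => ?_
    have hrow : (∑ s : Pd k, (if TotDist q s = true then (1:ℤ) else 0)) = 2 ^ k := by
      rw [Finset.sum_congr rfl fun s _ => ite_totDist_comm q s]
      exact sum_ite_totDist_eq_pow q
    have e5 : (∑ s : Pd k, ind A0 q * ind V q * (if TotDist q s = true then (1:ℤ) else 0) * (1 - ind Bp s))
        = ind A0 q * ind V q * (∑ s : Pd k, (if TotDist q s = true then (1:ℤ) else 0))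
          - ∑ s : Pd k, ind A0 q * ind Bp s * (if TotDist q s = true then (1:ℤ) else 0) * ind V q := by
      rw [Finset.mul_sum, ← Finset.sum_sub_distrib]
      refine Finset.sum_congr rfl fun s _ => ?_; ring
    rw [e5, hrow]; ring
  rw [eL, eR] at hPT
  linarith

/-- **(CR′) at `B = ⊤`, every `k`, all up-sets `A₀, B′, V`**: `κ′_V(A₀,B′) ≤ 2·H_V(A₀∩B′) + H_V(A₀)` (in indicator sums; `H_V(A₀) = h_V(⊤,A₀)`,
`h_V(A₀,⊤) = 0`). [this work] -/
theorem cr_top (hV : IsUpperSet (V : Set (Pd k))) {A0 Bp : Finset (Pd k)}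
    (hA0 : IsUpperSet (A0 : Set (Pd k))) (hBp : IsUpperSet (Bp : Set (Pd k))) :
    (∑ q : Pd k, ∑ r : Pd k, ind A0 q * ind Bp r * (if TotDist q r = true then (1:ℤ) else 0) * ind V q)
      - (∑ q : Pd k, ∑ r : Pd k, ind A0 q * ind Bp r * (if TotDist q r = true then (1:ℤ) else 0) * ind V (thirdPt q r))
      ≤ 2 * ((2:ℤ) ^ k * (∑ q : Pd k, ind A0 q * ind Bp q * ind V q)
              - ∑ q : Pd k, ∑ r : Pd k, ind A0 q * ind Bp q * (if TotDist q r = true then (1:ℤ) else 0) * ind V r)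
        + ((2:ℤ) ^ k * (∑ q : Pd k, ind A0 q * ind V q)
              - ∑ q : Pd k, ∑ r : Pd k, ind A0 q * (if TotDist q r = true then (1:ℤ) else 0) * ind V r) := by
  have h1 := kappa_le_harris_of_pairThird hV Bp hA0
  -- Harris for (A0∩B′, V): N(A0∩B′∩?; ...) : Σ 1_F(q)[td]1_V(r) ≤ 2^k #(F∩V)
  have hH : (∑ q : Pd k, ∑ r : Pd k, ind A0 q * ind Bp q * (if TotDist q r = true then (1:ℤ) else 0) * ind V r)
      ≤ (2:ℤ) ^ k * (∑ q : Pd k, ind A0 q * ind Bp q * ind V q) := by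
    have h := pairCount_le_harris' (X := A0 ∩ Bp) (Y := (univ : Finset (Pd k))) hV (isUpperSet_inter_coe hA0 hBp)
      (by rw [Finset.coe_univ]; exact isUpperSet_univ)
    have e1 : (∑ q : Pd k, ∑ r : Pd k, ind (A0 ∩ Bp) q * ind (univ : Finset (Pd k)) r * (if TotDist q r = true then (1:ℤ) else 0) * ind V r)
        = ∑ q : Pd k, ∑ r : Pd k, ind A0 q * ind Bp q * (if TotDist q r = true then (1:ℤ) else 0) * ind V r := by
      refine Finset.sum_congr rfl fun q _ => Finset.sum_congr rfl fun r _ => ?_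
      rw [ind_inter_eq_mul]; unfold ind; simp only [Finset.mem_univ, if_true]; ring
    have e2 : (∑ q : Pd k, ind (A0 ∩ Bp) q * ind (univ : Finset (Pd k)) q * ind V q) = ∑ q : Pd k, ind A0 q * ind Bp q * ind V q := by
      refine Finset.sum_congr rfl fun q _ => ?_
      rw [ind_inter_eq_mul]; unfold ind; simp only [Finset.mem_univ, if_true]; ring
    rw [e1, e2] at h
    exact h
  linarith

/-- `1_⊤ ≡ 1`. [this work] -/
theorem ind_univ_eq_one (q : Pd k) : ind (univ : Finset (Pd k)) q = 1 := by
  unfold ind; simp only [Finset.mem_univ, if_true]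

/-- Row sums of the `δ̸` indicator: `Σ_r [q δ̸ r] = 2^k`. [this work] -/
theorem sum_ite_totDist_eq_pow_left (q : Pd k) : (∑ r : Pd k, (if TotDist q r = true then (1:ℤ) else 0)) = 2 ^ k := by
  rw [Finset.sum_congr rfl fun r _ => ite_totDist_comm q r]
  exact sum_ite_totDist_eq_pow q

/-- `Σ_{q ∈ X∩Y} λ_V(q)` as `Σ_q 1_X 1_Y λ_V`. [this work] -/
theorem sum_inter_lamU_eq_sum_ind (V X Y : Finset (Pd k)) :
    (∑ q ∈ X ∩ Y, lamU V q) = ∑ q : Pd k, ind X q * ind Y q * lamU V q := by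
  rw [sum_mem_eq_sum_ind_mul (X ∩ Y)]
  refine Finset.sum_congr rfl fun q _ => ?_
  rw [ind_inter_eq_mul]

/-- **Goodness of `V` at the pair `(A₀, B′)` in pair-count form** (rewriting `Θ_V(A₀×B′) ≤ λ_V(A₀∩B′)`). [this work] -/
theorem good_pair_counts {A0 Bp : Finset (Pd k)}
    (hG : (∑ q ∈ A0, ∑ r ∈ Bp, thetaVal V q r) ≤ ∑ q ∈ A0 ∩ Bp, lamU V q) :
    (∑ q : Pd k, ∑ r : Pd k, ind A0 q * ind Bp r * (if TotDist q r = true then (1:ℤ) else 0) * ind V q)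
      + (∑ q : Pd k, ∑ r : Pd k, ind A0 q * ind Bp r * (if TotDist q r = true then (1:ℤ) else 0) * ind V r)
      - (∑ q : Pd k, ∑ r : Pd k, ind A0 q * ind Bp r * (if TotDist q r = true then (1:ℤ) else 0) * ind V (thirdPt q r))
      ≤ 2 * (2:ℤ) ^ k * (∑ q : Pd k, ind A0 q * ind Bp q * ind V q)
        - ∑ q : Pd k, ∑ r : Pd k, ind A0 q * ind Bp q * (if TotDist q r = true then (1:ℤ) else 0) * ind V r := by
  have h := hG
  rw [theta_rect_eq_counts V A0 Bp, sum_inter_lamU_eq V A0 Bp] at h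
  exact h

/-- **Every up-set `V` is good at the pairs `(A₀, ⊤)`** (`Θ_V(A₀×⊤) = 2^k·#(A₀∩V) ≤ λ_V(A₀)` is coefficientwise Harris). [this work] -/
theorem good_at_univ (hV : IsUpperSet (V : Set (Pd k))) {A0 : Finset (Pd k)} (hA0 : IsUpperSet (A0 : Set (Pd k))) :
    (∑ q ∈ A0, ∑ r ∈ (univ : Finset (Pd k)), thetaVal V q r) ≤ ∑ q ∈ A0 ∩ univ, lamU V q := by
  rw [theta_rect_eq_counts V A0 univ, sum_inter_lamU_eq V A0 univ]
  simp only [ind_univ_eq_one, mul_one]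
  -- the Latin count equals the partner count (swap partner and third point), the diagonal count is the row sum
  have e1 : (∑ q : Pd k, ∑ r : Pd k, ind A0 q * (if TotDist q r = true then (1:ℤ) else 0) * ind V (thirdPt q r))
      = ∑ q : Pd k, ∑ r : Pd k, ind A0 q * (if TotDist q r = true then (1:ℤ) else 0) * ind V r := by
    refine Finset.sum_congr rfl fun q _ => ?_
    have h := sum_partner_third_swap q (fun _ => (1:ℤ)) (fun r => ind V r)
    have e3 : (∑ r : Pd k, ind A0 q * (if TotDist q r = true then (1:ℤ) else 0) * ind V (thirdPt q r))
        = ind A0 q * ∑ r : Pd k, (if TotDist q r = true then (1:ℤ) else 0) * (fun _ => (1:ℤ)) r * ind V (thirdPt q r) := by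
      rw [Finset.mul_sum]; refine Finset.sum_congr rfl fun r _ => ?_; ring
    have e4 : (∑ r : Pd k, ind A0 q * (if TotDist q r = true then (1:ℤ) else 0) * ind V r)
        = ind A0 q * ∑ r : Pd k, (if TotDist q r = true then (1:ℤ) else 0) * (fun _ => (1:ℤ)) (thirdPt q r) * ind V r := by
      rw [Finset.mul_sum]; refine Finset.sum_congr rfl fun r _ => ?_; ring
    rw [e3, e4, h]
  have e2 : (∑ q : Pd k, ∑ r : Pd k, ind A0 q * (if TotDist q r = true then (1:ℤ) else 0) * ind V q)
      = (2:ℤ) ^ k * ∑ q : Pd k, ind A0 q * ind V q := by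
    rw [Finset.mul_sum]
    refine Finset.sum_congr rfl fun q _ => ?_
    have e5 : (∑ r : Pd k, ind A0 q * (if TotDist q r = true then (1:ℤ) else 0) * ind V q)
        = ind A0 q * ind V q * ∑ r : Pd k, (if TotDist q r = true then (1:ℤ) else 0) := by
      rw [Finset.mul_sum]; refine Finset.sum_congr rfl fun r _ => ?_; ring
    rw [e5, sum_ite_totDist_eq_pow_left q]; ring
  have hH : (∑ q : Pd k, ∑ r : Pd k, ind A0 q * (if TotDist q r = true then (1:ℤ) else 0) * ind V r)
      ≤ (2:ℤ) ^ k * ∑ q : Pd k, ind A0 q * ind V q := by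
    have h := pairCount_le_harris' (X := A0) (Y := (univ : Finset (Pd k))) hV hA0 (by rw [Finset.coe_univ]; exact isUpperSet_univ)
    simp only [ind_univ_eq_one, mul_one] at h
    exact h
  rw [e1, e2]
  linarith

/-- **THE CROSSED FAMILY AT THE CANONICAL CERTIFICATE, every `k` (reduction).**  `S = x∨y` with `c = (0 | 4 | 2 | 5)`, `A = S×V`, inner vector
`d_V = λ_V`; crossed pair `P = {x≥1}×A₀`, `Q = {q∈B′} ∪ ({y≥1}×B)`, `B′ ⊆ B`.  If `V` is good at the two section rectangles `(A₀,B)` and `(A₀,B′)` (hypotheses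
`hGB`, `hGBp`: `Θ_V ≤ λ_V`) and (CR′) `κ′_V(A₀,B′) ≤ 2H_V(A₀∩B′) + h_V(A₀,B) + h_V(B,A₀)` holds (hypothesis `hCR`, indicator sums), then the co-count product
`e = 2^{k+3}1_S 1_V − (8·1_S − c)(2^{k+1}1_V − λ_V)` satisfies (N) at `(P,Q)`.  [Uses the identity `H_V(F) + h_V(B′,A₀) − κ′ = Φ_V(A₀,B′)`.] [this work] -/
theorem diagCert_coProduct_N_orTwo_crossed_canonical (hS : ∀ ξ η : Pd 1, glue ξ η ∈ S ↔ (1 ≤ ξ 0 ∨ 1 ≤ η 0))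
    (hFx : ∀ ξ η : Pd 1, glue ξ η ∈ Fx ↔ 1 ≤ ξ 0) (hGy : ∀ ξ η : Pd 1, glue ξ η ∈ Gy ↔ 1 ≤ η 0)
    (hA : ∀ σ z, glue σ z ∈ A ↔ (σ ∈ S ∧ z ∈ V))
    (dS : Pd (1 + 1) → ℤ) (hdS : dS (glue (fun _ => 0) (fun _ => 0)) = 0 ∧ dS (glue (fun _ => 0) (fun _ => 1)) = 4 ∧ dS (glue (fun _ => 0) (fun _ => 2)) = 4 ∧
      dS (glue (fun _ => 1) (fun _ => 0)) = 2 ∧ dS (glue (fun _ => 1) (fun _ => 1)) = 5 ∧ dS (glue (fun _ => 1) (fun _ => 2)) = 5 ∧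
      dS (glue (fun _ => 2) (fun _ => 0)) = 2 ∧ dS (glue (fun _ => 2) (fun _ => 1)) = 5 ∧ dS (glue (fun _ => 2) (fun _ => 2)) = 5)
    {A0 Bp B0 : Finset (Pd k)} (hsub : Bp ⊆ B0)
    (hGB : (∑ q ∈ A0, ∑ r ∈ B0, thetaVal V q r) ≤ ∑ q ∈ A0 ∩ B0, lamU V q)
    (hGBp : (∑ q ∈ A0, ∑ r ∈ Bp, thetaVal V q r) ≤ ∑ q ∈ A0 ∩ Bp, lamU V q)
    (hCR : (∑ q : Pd k, ∑ r : Pd k, ind A0 q * ind Bp r * (if TotDist q r = true then (1:ℤ) else 0) * ind V q)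
        - (∑ q : Pd k, ∑ r : Pd k, ind A0 q * ind Bp r * (if TotDist q r = true then (1:ℤ) else 0) * ind V (thirdPt q r))
      ≤ 2 * ((2:ℤ) ^ k * (∑ q : Pd k, ind A0 q * ind Bp q * ind V q)
              - ∑ q : Pd k, ∑ r : Pd k, ind A0 q * ind Bp q * (if TotDist q r = true then (1:ℤ) else 0) * ind V r)
        + ((2:ℤ) ^ k * (∑ q : Pd k, ind A0 q * ind B0 q * ind V q) - (∑ q : Pd k, ∑ r : Pd k, ind A0 q * ind B0 r * (if TotDist q r = true then (1:ℤ) else 0) * ind V q))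
        + ((2:ℤ) ^ k * (∑ q : Pd k, ind A0 q * ind B0 q * ind V q) - (∑ q : Pd k, ∑ r : Pd k, ind A0 q * ind B0 r * (if TotDist q r = true then (1:ℤ) else 0) * ind V r)))
    {P Q : Finset (Pd ((1 + 1) + k))} (hP : ∀ σ q, glue σ q ∈ P ↔ (σ ∈ Fx ∧ q ∈ A0)) (hQ : ∀ σ q, glue σ q ∈ Q ↔ (q ∈ Bp ∨ (σ ∈ Gy ∧ q ∈ B0))) :
    (∑ x ∈ P, ∑ y ∈ Q, thetaVal A x y) ≤ ∑ x ∈ P ∩ Q, (2 * (2:ℤ) ^ ((1 + 1) + k) * (ind S (freeOf x) * ind V (cellOf x))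
        - (2 * (2:ℤ) ^ (1 + 1) * ind S (freeOf x) - dS (freeOf x)) * (2 * (2:ℤ) ^ k * ind V (cellOf x) - lamU V (cellOf x))) := by
  have hrow := good_pair_counts (V := V) hGBp
  have ey : (∑ q : Pd k, ind A0 q * ind Bp q * lamU V q) = 2 * (2:ℤ) ^ k * (∑ q : Pd k, ind A0 q * ind Bp q * ind V q)
      - ∑ q : Pd k, ∑ r : Pd k, ind A0 q * ind Bp q * (if TotDist q r = true then (1:ℤ) else 0) * ind V r := by
    rw [← sum_inter_lamU_eq_sum_ind, sum_inter_lamU_eq]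
  refine diagCert_coProduct_N_orTwo_crossed hS hFx hGy hA dS hdS (lamU V) hsub hGB ?_ hP hQ
  rw [ey]
  linarith [hrow, hCR]

/-- **UNCONDITIONAL: the crossed family with `B = ⊤` at the canonical certificate, every `k`, EVERY up-set `V`.**  For up-sets `V, A₀, B′` with `V` good at
the single rectangle `(A₀,B′)`, the co-count product `e = co(c, λ_V)` of `S = x∨y` and `V` satisfies (N) at the crossed pair `P = {x≥1}×A₀`,
`Q = {q ∈ B′} ∪ {y ≥ 1}` (i.e. `B = ⊤`).  (CR′) there is `cr_top`; goodness at `(A₀,⊤)` is `good_at_univ`. [this work] -/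
theorem diagCert_coProduct_N_orTwo_crossed_canonical_top (hS : ∀ ξ η : Pd 1, glue ξ η ∈ S ↔ (1 ≤ ξ 0 ∨ 1 ≤ η 0))
    (hFx : ∀ ξ η : Pd 1, glue ξ η ∈ Fx ↔ 1 ≤ ξ 0) (hGy : ∀ ξ η : Pd 1, glue ξ η ∈ Gy ↔ 1 ≤ η 0)
    (hV : IsUpperSet (V : Set (Pd k))) (hA : ∀ σ z, glue σ z ∈ A ↔ (σ ∈ S ∧ z ∈ V))
    (dS : Pd (1 + 1) → ℤ) (hdS : dS (glue (fun _ => 0) (fun _ => 0)) = 0 ∧ dS (glue (fun _ => 0) (fun _ => 1)) = 4 ∧ dS (glue (fun _ => 0) (fun _ => 2)) = 4 ∧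
      dS (glue (fun _ => 1) (fun _ => 0)) = 2 ∧ dS (glue (fun _ => 1) (fun _ => 1)) = 5 ∧ dS (glue (fun _ => 1) (fun _ => 2)) = 5 ∧
      dS (glue (fun _ => 2) (fun _ => 0)) = 2 ∧ dS (glue (fun _ => 2) (fun _ => 1)) = 5 ∧ dS (glue (fun _ => 2) (fun _ => 2)) = 5)
    {A0 Bp : Finset (Pd k)} (hA0 : IsUpperSet (A0 : Set (Pd k))) (hBp : IsUpperSet (Bp : Set (Pd k)))
    (hGBp : (∑ q ∈ A0, ∑ r ∈ Bp, thetaVal V q r) ≤ ∑ q ∈ A0 ∩ Bp, lamU V q)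
    {P Q : Finset (Pd ((1 + 1) + k))} (hP : ∀ σ q, glue σ q ∈ P ↔ (σ ∈ Fx ∧ q ∈ A0))
    (hQ : ∀ σ q, glue σ q ∈ Q ↔ (q ∈ Bp ∨ (σ ∈ Gy ∧ q ∈ (univ : Finset (Pd k))))) :
    (∑ x ∈ P, ∑ y ∈ Q, thetaVal A x y) ≤ ∑ x ∈ P ∩ Q, (2 * (2:ℤ) ^ ((1 + 1) + k) * (ind S (freeOf x) * ind V (cellOf x))
        - (2 * (2:ℤ) ^ (1 + 1) * ind S (freeOf x) - dS (freeOf x)) * (2 * (2:ℤ) ^ k * ind V (cellOf x) - lamU V (cellOf x))) := by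
  have hcr := cr_top hV hA0 hBp
  refine diagCert_coProduct_N_orTwo_crossed_canonical hS hFx hGy hA dS hdS (Finset.subset_univ Bp) (good_at_univ hV hA0) hGBp ?_ hP hQ
  simp only [ind_univ_eq_one, mul_one]
  -- with `B = ⊤`: the first Harris bracket vanishes (row sums), the second is `H_V(A₀)`
  have e2 : (∑ q : Pd k, ∑ r : Pd k, ind A0 q * (if TotDist q r = true then (1:ℤ) else 0) * ind V q)
      = (2:ℤ) ^ k * ∑ q : Pd k, ind A0 q * ind V q := by
    rw [Finset.mul_sum]
    refine Finset.sum_congr rfl fun q _ => ?_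
    have e5 : (∑ r : Pd k, ind A0 q * (if TotDist q r = true then (1:ℤ) else 0) * ind V q)
        = ind A0 q * ind V q * ∑ r : Pd k, (if TotDist q r = true then (1:ℤ) else 0) := by
      rw [Finset.mul_sum]; refine Finset.sum_congr rfl fun r _ => ?_; ring
    rw [e5, sum_ite_totDist_eq_pow_left q]; ring
  rw [e2]
  linarith [hcr]

/-- **The pattern functional at these pairs** (with (T) and the box for `dS` in addition): `0 ≤ sStarD ((x∨y)×V) P Q` at every crossed pair with `B = ⊤`, for
every up-set `V` good at `(A₀,B′)` — every `k`. [this work] -/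
theorem sStarD_blockAnd_orTwo_crossed_top_nonneg (hS : ∀ ξ η : Pd 1, glue ξ η ∈ S ↔ (1 ≤ ξ 0 ∨ 1 ≤ η 0))
    (hFx : ∀ ξ η : Pd 1, glue ξ η ∈ Fx ↔ 1 ≤ ξ 0) (hGy : ∀ ξ η : Pd 1, glue ξ η ∈ Gy ↔ 1 ≤ η 0)
    (hV : IsUpperSet (V : Set (Pd k))) (hA : ∀ σ z, glue σ z ∈ A ↔ (σ ∈ S ∧ z ∈ V))
    (dS : Pd (1 + 1) → ℤ) (hdS : dS (glue (fun _ => 0) (fun _ => 0)) = 0 ∧ dS (glue (fun _ => 0) (fun _ => 1)) = 4 ∧ dS (glue (fun _ => 0) (fun _ => 2)) = 4 ∧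
      dS (glue (fun _ => 1) (fun _ => 0)) = 2 ∧ dS (glue (fun _ => 1) (fun _ => 1)) = 5 ∧ dS (glue (fun _ => 1) (fun _ => 2)) = 5 ∧
      dS (glue (fun _ => 2) (fun _ => 0)) = 2 ∧ dS (glue (fun _ => 2) (fun _ => 1)) = 5 ∧ dS (glue (fun _ => 2) (fun _ => 2)) = 5)
    (hTS : ∀ W : Finset (Pd (1 + 1)), IsUpperSet (W : Set (Pd (1 + 1))) → (∑ ξ ∈ W, dS ξ) ≤ ∑ ξ ∈ W, lamU S ξ)
    (hmS : ∀ ξ : Pd (1 + 1), dS ξ ≤ 2 * (2:ℤ) ^ (1 + 1) * ind S ξ)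
    {A0 Bp : Finset (Pd k)} (hA0 : IsUpperSet (A0 : Set (Pd k))) (hBp : IsUpperSet (Bp : Set (Pd k)))
    (hGBp : (∑ q ∈ A0, ∑ r ∈ Bp, thetaVal V q r) ≤ ∑ q ∈ A0 ∩ Bp, lamU V q)
    {P Q : Finset (Pd ((1 + 1) + k))} (hPu : IsUpperSet (P : Set (Pd ((1 + 1) + k)))) (hQu : IsUpperSet (Q : Set (Pd ((1 + 1) + k))))
    (hP : ∀ σ q, glue σ q ∈ P ↔ (σ ∈ Fx ∧ q ∈ A0)) (hQ : ∀ σ q, glue σ q ∈ Q ↔ (q ∈ Bp ∨ (σ ∈ Gy ∧ q ∈ (univ : Finset (Pd k))))) :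
    0 ≤ sStarD A P Q := by
  rw [sStarD_eq_sum_lamU_sub_sum_thetaVal]
  have hTV : ∀ W : Finset (Pd k), IsUpperSet (W : Set (Pd k)) → (∑ q ∈ W, lamU V q) ≤ ∑ q ∈ W, lamU V q := fun W _ => le_rfl
  have hT := diagCert_coProduct_T hA dS (lamU V) hTS hTV hmS (isUpperSet_inter_coe hPu hQu)
  have hN := diagCert_coProduct_N_orTwo_crossed_canonical_top hS hFx hGy hV hA dS hdS hA0 hBp hGBp hP hQ
  linarith

/-! ### Addendum (same generation): (CR′) — hence the crossed (N) at the canonical certificate — whenever `A₀ ∩ V ⊆ B`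
For `A₀ ∩ V ⊆ B` the crossing count `N(B∩V; A₀)` is at most `N(V; A₀)` while the diagonal count is unchanged, so `h_V(B,A₀) ≥ H_V(A₀) ≥ κ′_V(A₀,B′)`
(`kappa_le_harris_of_pairThird`); with `H_V(A₀∩B′) ≥ 0` and `h_V(A₀,B) ≥ 0` (Harris) this is (CR′).  The case `B = ⊤` above is the special case `A₀ ∩ V ⊆ ⊤`.
So at the canonical inner certificate the crossed family is settled, for EVERY up-set `V` (good at the two section rectangles), on the whole sub-family
`A₀ ∩ V ⊆ B` — in particular whenever `B ⊇ A₀`; the remaining crossed pairs are exactly those with a point of `A₀ ∩ V` outside `B`, where (CR′) is the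
open inequality (true for `k ≤ 3` exhaustively). -/

/-- **(CR′) whenever `A₀ ∩ V ⊆ B`, every `k`, all up-sets `A₀, B′, B, V`** (no inclusion `B′ ⊆ B` needed for this inequality): then
`h_V(B,A₀) ≥ H_V(A₀)` (fewer crossing pairs), so `κ′ ≤ H_V(A₀) ≤ h_V(B,A₀) ≤ 2H_V(A₀∩B′) + h_V(A₀,B) + h_V(B,A₀)` by `kappa_le_harris_of_pairThird`
and two Harris inequalities. [this work] -/
theorem cr_of_cornerSub (hV : IsUpperSet (V : Set (Pd k))) {A0 Bp B0 : Finset (Pd k)}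
    (hA0 : IsUpperSet (A0 : Set (Pd k))) (hBp : IsUpperSet (Bp : Set (Pd k))) (hB0 : IsUpperSet (B0 : Set (Pd k)))
    (hAB : A0 ∩ V ⊆ B0) :
    (∑ q : Pd k, ∑ r : Pd k, ind A0 q * ind Bp r * (if TotDist q r = true then (1:ℤ) else 0) * ind V q)
      - (∑ q : Pd k, ∑ r : Pd k, ind A0 q * ind Bp r * (if TotDist q r = true then (1:ℤ) else 0) * ind V (thirdPt q r))
      ≤ 2 * ((2:ℤ) ^ k * (∑ q : Pd k, ind A0 q * ind Bp q * ind V q)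
              - ∑ q : Pd k, ∑ r : Pd k, ind A0 q * ind Bp q * (if TotDist q r = true then (1:ℤ) else 0) * ind V r)
        + ((2:ℤ) ^ k * (∑ q : Pd k, ind A0 q * ind B0 q * ind V q) - (∑ q : Pd k, ∑ r : Pd k, ind A0 q * ind B0 r * (if TotDist q r = true then (1:ℤ) else 0) * ind V q))
        + ((2:ℤ) ^ k * (∑ q : Pd k, ind A0 q * ind B0 q * ind V q) - (∑ q : Pd k, ∑ r : Pd k, ind A0 q * ind B0 r * (if TotDist q r = true then (1:ℤ) else 0) * ind V r)) := by
  have h1 := kappa_le_harris_of_pairThird hV Bp hA0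
  -- Harris for (A0∩B′, V) and for (A0, B0) weighted by V at q
  have hH : (∑ q : Pd k, ∑ r : Pd k, ind A0 q * ind Bp q * (if TotDist q r = true then (1:ℤ) else 0) * ind V r)
      ≤ (2:ℤ) ^ k * (∑ q : Pd k, ind A0 q * ind Bp q * ind V q) := by
    have h := pairCount_le_harris' (X := A0 ∩ Bp) (Y := (univ : Finset (Pd k))) hV (isUpperSet_inter_coe hA0 hBp)
      (by rw [Finset.coe_univ]; exact isUpperSet_univ)
    have e1 : (∑ q : Pd k, ∑ r : Pd k, ind (A0 ∩ Bp) q * ind (univ : Finset (Pd k)) r * (if TotDist q r = true then (1:ℤ) else 0) * ind V r)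
        = ∑ q : Pd k, ∑ r : Pd k, ind A0 q * ind Bp q * (if TotDist q r = true then (1:ℤ) else 0) * ind V r := by
      refine Finset.sum_congr rfl fun q _ => Finset.sum_congr rfl fun r _ => ?_
      rw [ind_inter_eq_mul]; unfold ind; simp only [Finset.mem_univ, if_true]; ring
    have e2 : (∑ q : Pd k, ind (A0 ∩ Bp) q * ind (univ : Finset (Pd k)) q * ind V q) = ∑ q : Pd k, ind A0 q * ind Bp q * ind V q := by
      refine Finset.sum_congr rfl fun q _ => ?_
      rw [ind_inter_eq_mul]; unfold ind; simp only [Finset.mem_univ, if_true]; ring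
    rw [e1, e2] at h
    exact h
  have hH2 : (∑ q : Pd k, ∑ r : Pd k, ind A0 q * ind B0 r * (if TotDist q r = true then (1:ℤ) else 0) * ind V q)
      ≤ (2:ℤ) ^ k * (∑ q : Pd k, ind A0 q * ind B0 q * ind V q) := pairCount_le_harris hV hA0 hB0
  -- `A0 ∩ V ⊆ B0`: the diagonal count with `B0` is the one without, and the crossing count only drops
  have e3 : (∑ q : Pd k, ind A0 q * ind B0 q * ind V q) = ∑ q : Pd k, ind A0 q * ind V q := by
    refine Finset.sum_congr rfl fun q _ => ?_
    by_cases hq : q ∈ A0 ∩ V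
    · have hq' : q ∈ B0 := hAB hq
      rw [Finset.mem_inter] at hq
      unfold ind; rw [if_pos hq.1, if_pos hq.2, if_pos hq']; ring
    · rw [Finset.mem_inter, not_and_or] at hq
      unfold ind
      rcases hq with hq | hq
      · rw [if_neg hq]; ring
      · rw [if_neg hq]; ring
  have h4 : (∑ q : Pd k, ∑ r : Pd k, ind A0 q * ind B0 r * (if TotDist q r = true then (1:ℤ) else 0) * ind V r)
      ≤ ∑ q : Pd k, ∑ r : Pd k, ind A0 q * (if TotDist q r = true then (1:ℤ) else 0) * ind V r := by
    refine Finset.sum_le_sum fun q _ => Finset.sum_le_sum fun r _ => ?_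
    have hA0q : 0 ≤ ind A0 q := by unfold ind; split_ifs <;> norm_num
    have hVr : 0 ≤ ind V r := by unfold ind; split_ifs <;> norm_num
    have hT : 0 ≤ (if TotDist q r = true then (1:ℤ) else 0) := by split_ifs <;> norm_num
    have hB : ind B0 r ≤ 1 := by unfold ind; split_ifs <;> norm_num
    nlinarith [mul_nonneg (mul_nonneg hA0q hT) hVr]
  rw [e3] at hH2
  rw [e3]
  linarith

/-- **UNCONDITIONAL: the crossed family with `A₀ ∩ V ⊆ B` at the canonical certificate — every `k`, EVERY up-set `V`.**  For up-sets `V, A₀, B′ ⊆ B` with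
`A₀ ∩ V ⊆ B` (e.g. `B = ⊤`, or `B ⊇ A₀`) and `V` good at the two rectangles `(A₀,B)`, `(A₀,B′)`, the co-count product `e = co(c, λ_V)` of `S = x∨y` and `V`
satisfies (N) at the crossed pair `P = {x≥1}×A₀`, `Q = {q∈B′} ∪ ({y≥1}×B)`. [this work] -/
theorem diagCert_coProduct_N_orTwo_crossed_canonical_of_cornerSub (hS : ∀ ξ η : Pd 1, glue ξ η ∈ S ↔ (1 ≤ ξ 0 ∨ 1 ≤ η 0))
    (hFx : ∀ ξ η : Pd 1, glue ξ η ∈ Fx ↔ 1 ≤ ξ 0) (hGy : ∀ ξ η : Pd 1, glue ξ η ∈ Gy ↔ 1 ≤ η 0)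
    (hV : IsUpperSet (V : Set (Pd k))) (hA : ∀ σ z, glue σ z ∈ A ↔ (σ ∈ S ∧ z ∈ V))
    (dS : Pd (1 + 1) → ℤ) (hdS : dS (glue (fun _ => 0) (fun _ => 0)) = 0 ∧ dS (glue (fun _ => 0) (fun _ => 1)) = 4 ∧ dS (glue (fun _ => 0) (fun _ => 2)) = 4 ∧
      dS (glue (fun _ => 1) (fun _ => 0)) = 2 ∧ dS (glue (fun _ => 1) (fun _ => 1)) = 5 ∧ dS (glue (fun _ => 1) (fun _ => 2)) = 5 ∧
      dS (glue (fun _ => 2) (fun _ => 0)) = 2 ∧ dS (glue (fun _ => 2) (fun _ => 1)) = 5 ∧ dS (glue (fun _ => 2) (fun _ => 2)) = 5)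
    {A0 Bp B0 : Finset (Pd k)} (hA0 : IsUpperSet (A0 : Set (Pd k))) (hBp : IsUpperSet (Bp : Set (Pd k))) (hB0 : IsUpperSet (B0 : Set (Pd k)))
    (hsub : Bp ⊆ B0) (hAB : A0 ∩ V ⊆ B0)
    (hGB : (∑ q ∈ A0, ∑ r ∈ B0, thetaVal V q r) ≤ ∑ q ∈ A0 ∩ B0, lamU V q)
    (hGBp : (∑ q ∈ A0, ∑ r ∈ Bp, thetaVal V q r) ≤ ∑ q ∈ A0 ∩ Bp, lamU V q)
    {P Q : Finset (Pd ((1 + 1) + k))} (hP : ∀ σ q, glue σ q ∈ P ↔ (σ ∈ Fx ∧ q ∈ A0)) (hQ : ∀ σ q, glue σ q ∈ Q ↔ (q ∈ Bp ∨ (σ ∈ Gy ∧ q ∈ B0))) :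
    (∑ x ∈ P, ∑ y ∈ Q, thetaVal A x y) ≤ ∑ x ∈ P ∩ Q, (2 * (2:ℤ) ^ ((1 + 1) + k) * (ind S (freeOf x) * ind V (cellOf x))
        - (2 * (2:ℤ) ^ (1 + 1) * ind S (freeOf x) - dS (freeOf x)) * (2 * (2:ℤ) ^ k * ind V (cellOf x) - lamU V (cellOf x))) :=
  diagCert_coProduct_N_orTwo_crossed_canonical hS hFx hGy hA dS hdS hsub hGB hGBp (cr_of_cornerSub hV hA0 hBp hB0 hAB) hP hQ

/-- **The pattern functional there** (with (T) and the box for `dS`): `0 ≤ sStarD ((x∨y)×V) P Q` at every crossed pair with `A₀ ∩ V ⊆ B`, for every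
up-set `V` good at `(A₀,B)` and `(A₀,B′)` — every `k`. [this work] -/
theorem sStarD_blockAnd_orTwo_crossed_cornerSub_nonneg (hS : ∀ ξ η : Pd 1, glue ξ η ∈ S ↔ (1 ≤ ξ 0 ∨ 1 ≤ η 0))
    (hFx : ∀ ξ η : Pd 1, glue ξ η ∈ Fx ↔ 1 ≤ ξ 0) (hGy : ∀ ξ η : Pd 1, glue ξ η ∈ Gy ↔ 1 ≤ η 0)
    (hV : IsUpperSet (V : Set (Pd k))) (hA : ∀ σ z, glue σ z ∈ A ↔ (σ ∈ S ∧ z ∈ V))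
    (dS : Pd (1 + 1) → ℤ) (hdS : dS (glue (fun _ => 0) (fun _ => 0)) = 0 ∧ dS (glue (fun _ => 0) (fun _ => 1)) = 4 ∧ dS (glue (fun _ => 0) (fun _ => 2)) = 4 ∧
      dS (glue (fun _ => 1) (fun _ => 0)) = 2 ∧ dS (glue (fun _ => 1) (fun _ => 1)) = 5 ∧ dS (glue (fun _ => 1) (fun _ => 2)) = 5 ∧
      dS (glue (fun _ => 2) (fun _ => 0)) = 2 ∧ dS (glue (fun _ => 2) (fun _ => 1)) = 5 ∧ dS (glue (fun _ => 2) (fun _ => 2)) = 5)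
    (hTS : ∀ W : Finset (Pd (1 + 1)), IsUpperSet (W : Set (Pd (1 + 1))) → (∑ ξ ∈ W, dS ξ) ≤ ∑ ξ ∈ W, lamU S ξ)
    (hmS : ∀ ξ : Pd (1 + 1), dS ξ ≤ 2 * (2:ℤ) ^ (1 + 1) * ind S ξ)
    {A0 Bp B0 : Finset (Pd k)} (hA0 : IsUpperSet (A0 : Set (Pd k))) (hBp : IsUpperSet (Bp : Set (Pd k))) (hB0 : IsUpperSet (B0 : Set (Pd k)))
    (hsub : Bp ⊆ B0) (hAB : A0 ∩ V ⊆ B0)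
    (hGB : (∑ q ∈ A0, ∑ r ∈ B0, thetaVal V q r) ≤ ∑ q ∈ A0 ∩ B0, lamU V q)
    (hGBp : (∑ q ∈ A0, ∑ r ∈ Bp, thetaVal V q r) ≤ ∑ q ∈ A0 ∩ Bp, lamU V q)
    {P Q : Finset (Pd ((1 + 1) + k))} (hPu : IsUpperSet (P : Set (Pd ((1 + 1) + k)))) (hQu : IsUpperSet (Q : Set (Pd ((1 + 1) + k))))
    (hP : ∀ σ q, glue σ q ∈ P ↔ (σ ∈ Fx ∧ q ∈ A0)) (hQ : ∀ σ q, glue σ q ∈ Q ↔ (q ∈ Bp ∨ (σ ∈ Gy ∧ q ∈ B0))) :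
    0 ≤ sStarD A P Q := by
  rw [sStarD_eq_sum_lamU_sub_sum_thetaVal]
  have hTV : ∀ W : Finset (Pd k), IsUpperSet (W : Set (Pd k)) → (∑ q ∈ W, lamU V q) ≤ ∑ q ∈ W, lamU V q := fun W _ => le_rfl
  have hT := diagCert_coProduct_T hA dS (lamU V) hTS hTV hmS (isUpperSet_inter_coe hPu hQu)
  have hN := diagCert_coProduct_N_orTwo_crossed_canonical_of_cornerSub hS hFx hGy hV hA dS hdS hA0 hBp hB0 hsub hAB hGB hGBp hP hQ
  linarith

end CrossedCanonical

end Summit.CriticalPhenomena.PercolationContinuityZ3.Theorems.SahiGridPattern
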